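import Summits.AtomisticToContinuum.FouriersLaw.Theorems.OddSectorIrreversibilityTapLeakBoundFloorTail
import Summits.AtomisticToContinuum.FouriersLaw.Theorems.OddSectorIrreversibilityTapLeakBoundFloorSupTail
import Summits.AtomisticToContinuum.FouriersLaw.Theorems.OddSectorIrreversibilityTapLeakBoundFloorLocalMoments
import Summits.AtomisticToContinuum.FouriersLaw.Theorems.OddSectorIrreversibilityTapLeakBoundFloorGoodKick
import Summits.AtomisticToContinuum.FouriersLaw.Theorems.OddSectorIrreversibilityTapLeakBoundFloorBadSplit
import Summits.AtomisticToContinuum.FouriersLaw.Theorems.OddSectorIrreversibilityTapLeakBoundFloorWindow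
import Summits.AtomisticToContinuum.FouriersLaw.Theorems.OddSectorIrreversibilityTapLeakBoundFloorSupWindow

/-!
# `TapLeakBound` (stmt-AtomisticToContinuum-15159), line `SketchIdeator2`, second floor of `stub_kickCone`: every power window (core)

Helper file (`--supports stmt-AtomisticToContinuum-15159`) for crux P = `…Theses.OddSectorIrreversibility.TapLeakBound`,
registered stub `stub_kickCone` (C′: the `N`-uniform resampled-kick `L²(Gibbs)` cone of the CLOSED pinned FPU-β chain in a
LINEAR window — open). SECOND FLOOR of C′ (lead c3): `kickCone_supFloor_core m₀` / `stub_floorSupCore` — for every `m₀ ≥ 1`,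
contact `b = 0`, bond `i ≥ 1`, `s^{4m₀} ≤ a(1+i)^{4m₀-1}` (i.e. `s ≲ i^{1-1/(4m₀)}`; `m₀ = 1` is …FloorCore):
`∫∫ (j_i(Φ_s(q, p[0 ↦ p'])) − j_i(Φ_s(q,p)))² dN(0,T)(p') dμ_T ≤ C · Z/(1+i)³`, `a, C` depending on `(ω₂, lam, β, T, m₀)` only.
Against the first floor: the GOOD event caps the RUNNING MAXIMA of the `2i+3` block site energies along both flows (closed
sets, written as flags so that `measurableSet_goodSet` / `goodSet_resample_iff` / `prod_compl_goodSet_le` apply verbatim),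
priced by the SUP-IN-TIME maximal inequality `measureReal_sup_gt_le_pow` (…FloorSupTail: the window length is a prefactor
only) instead of the budget inequality (cap `E ≳ s`, whence `d^{3/4}`); so the cap drops to `E = lam R⁴/4` at the box scale
`R = (1+i)^{1/(4m₀)}` (…FloorSupWindow), the deterministic block cone (`stub_floorGoodKick`) needs only `32·A·R·s ≤ i`, and the
price `(2/E)^{8m₀} ×` (local moments of orders `8m₀`, `16m₀ − 2`; `stub_floorLocalMoments`) is `≍ (1+i)^{-8}`. NOT reached: the
linear window (a bounded cap fails with Gibbs probability `↛ 0`: energy may concentrate along the ray). References: folklore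
(MPPT 1978 / BCDM 2007 / Buttà–Marchioro 2016; Liouville + Markov + last exit). Nothing here closes the item.
-/


noncomputable section

open MeasureTheory ProbabilityTheory Filter Topology Set Function
open scoped NNReal ENNReal

namespace Summit.AtomisticToContinuum.FouriersLaw.Theorems.OddSectorIrreversibility.TapLeak

open Literature.MathematicalPhysics.KineticTheory.HeatConduction
open Literature.MathematicalPhysics.KineticTheory
open Summit.AtomisticToContinuum.FouriersLaw.Theorems.OddSectorWitness
open Summit.AtomisticToContinuum.FouriersLaw.Theorems.ClosedConeSensitivity.Negative.ZeroFrictionDictionary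
open Summit.AtomisticToContinuum.FouriersLaw.Theorems.OddSectorIrreversibility.Corrector

/-! ### An elementary pointwise bound for the weight of the maximal inequality -/

/-- `x^n (a + b) ≤ x^{2n}/2 + a² + b²` (AM–GM and `(a+b)² ≤ 2(a²+b²)`). [folklore] -/
theorem pow_mul_add_le_sq (x a b : ℝ) (n : ℕ) :
    x ^ n * (a + b) ≤ x ^ (2 * n) / 2 + (a ^ 2 + b ^ 2) := by
  have e : x ^ (2 * n) = (x ^ n) ^ 2 := by rw [pow_mul, ← pow_mul, mul_comm, pow_mul]
  rw [e]
  nlinarith [sq_nonneg (x ^ n - (a + b)), sq_nonneg (a - b)]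

section Core

variable {ω₂ lam β : ℝ} (hω : 0 < ω₂) (hl : 0 < lam) (hβ : 0 ≤ β) (γ : ℝ) {T : ℝ} (hT : 0 < T)
include hω hl hβ hT

set_option maxHeartbeats 4000000 in
-- one long bookkeeping proof (≈ 45 local objects); the default budget is exceeded by the context size alone
/-- **THE SECOND FLOOR OF THE KICK CONE, core form** (contact `b = 0`, bond `i ≥ 1`, window parameter `m₀ ≥ 1`): there are
`a > 0`, `C ≥ 0` depending only on `(ω₂, lam, β, T, m₀)` such that for every `N`, `1 ≤ i`, `i + 1 < N`, `s ≥ 0` with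
`s^{4m₀} ≤ a (1 + i)^{4m₀-1}`: `∫∫ (j_i(Φ_s(q, p[0 ↦ p'])) − j_i(Φ_s(q,p)))² dN(0,T)(p') dμ_T ≤ C · Z / (1 + i)³` (sup-caps at
`E = lam R⁴/4`, `R = (1+i)^{1/(4m₀)}`; block cone on the good event, Cauchy–Schwarz + sup-in-time maximal inequality off it). [folklore] -/
theorem kickCone_supFloor_core (m₀ : ℕ) (hm : 1 ≤ m₀) : ∃ a C : ℝ, 0 < a ∧ 0 ≤ C ∧
    ∀ (N : ℕ) (i : ℕ) (hi1 : 1 ≤ i) (hiN : i + 1 < N) (s : ℝ), 0 ≤ s → s ^ (4 * m₀) ≤ a * (1 + (i : ℝ)) ^ (4 * m₀ - 1) →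
    ∫ x, (∫ p', ((pinnedChain ω₂ lam β γ).bondCurrent N ⟨i, by omega⟩
          (detFlow ω₂ lam β N s (x.1, Function.update x.2 ⟨0, by omega⟩ p')) -
        (pinnedChain ω₂ lam β γ).bondCurrent N ⟨i, by omega⟩ (detFlow ω₂ lam β N s x)) ^ 2
          ∂(gaussianReal 0 (Real.toNNReal T))) ∂(gibbsWeight ω₂ lam β γ N T) ≤
      C * (∫ x, Real.exp (-((pinnedChain ω₂ lam β γ).hamiltonian N x) / T) ∂volume) / (1 + (i : ℝ)) ^ 3 := by
  set n : ℕ := 8 * m₀ - 1 with hn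
  have hn1 : n + 1 = 8 * m₀ := by omega
  obtain ⟨C4, hC4_0, hC4⟩ := stub_floorLocalMoments ω₂ lam β γ hω hl.le hβ T hT 4
  obtain ⟨Ck, hCk_0, hCk⟩ := stub_floorLocalMoments ω₂ lam β γ hω hl.le hβ T hT (8 * m₀)
  obtain ⟨C2n, hC2n_0, hC2n⟩ := stub_floorLocalMoments ω₂ lam β γ hω hl.le hβ T hT (2 * n)
  obtain ⟨C2, hC2_0, hC2⟩ := stub_floorLocalMoments ω₂ lam β γ hω hl.le hβ T hT 2
  obtain ⟨C1, hC1⟩ := SubBallisticWindow.GibbsMoments.stub_gibbsMoments ω₂ lam β γ hω hl.le hβ T hT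
    (SubBallisticWindow.GibbsPoincare.stub_gibbsPoincare ω₂ lam β γ hω hl.le hβ T hT) 1
  set A : ℝ := Real.sqrt (1 + ω₂ + 3 * lam + 12 * β) with hA
  have hA1 : 1 ≤ A := by
    rw [hA, Real.one_le_sqrt]; nlinarith
  have hA0 : 0 ≤ A := zero_le_one.trans hA1
  have hA2 : A ^ 2 = 1 + ω₂ + 3 * lam + 12 * β := by rw [hA, Real.sq_sqrt (by positivity)]
  set a : ℝ := ((64 * A) ^ (4 * m₀))⁻¹ with ha
  have ha0 : 0 < a := by positivity
  set K₀ : ℝ := 3 / 2 * (1 + 4 * β + (1 + lam) * A) with hK₀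
  have hK₀0 : 0 ≤ K₀ := by positivity
  set Kt : ℝ := (8 / lam) ^ (8 * m₀) * (Ck + (C2n / 2 + 2 * C2)) with hKt
  have hKt0 : 0 ≤ Kt := by positivity
  set Kb : ℝ := 6 * Kt with hKb
  have hKb0 : 0 ≤ Kb := by positivity
  set G9 : ℝ := (Nat.factorial 9 : ℝ) * Real.exp (3 / 4) * (4 / 3 : ℝ) ^ 9 with hG9
  have hG90 : 0 ≤ G9 := by positivity
  set Cg : ℝ := 2 * K₀ ^ 2 * (max C1 0 + T + 4 * A ^ 4) * G9 with hCg
  have hCg0 : 0 ≤ Cg := by positivity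
  refine ⟨a, Cg + 4 * Real.sqrt (Kb * C4), ha0, by positivity, fun N i hi1 hiN s hs hw => ?_⟩
  have hi0 : (0 : ℝ) ≤ i := Nat.cast_nonneg i
  have h1i : (0 : ℝ) < 1 + i := by linarith
  have h1i1 : (1 : ℝ) ≤ 1 + i := by linarith
  set R : ℝ := (1 + (i : ℝ)) ^ ((4 * (m₀ : ℝ))⁻¹) with hR
  have hR1 : 1 ≤ R := one_le_rpow_window m₀ i
  have hR0 : 0 ≤ R := zero_le_one.trans hR1
  have hR4m : R ^ (4 * m₀) = 1 + (i : ℝ) := rpow_window_pow m₀ i hm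
  have hR3 : R ^ 3 ≤ 1 + (i : ℝ) := rpow_window_pow_le m₀ i 3 hm (by omega)
  set E : ℝ := lam * R ^ 4 / 4 with hE
  have hEpos : 0 < E := by positivity
  have hE0 : 0 ≤ E := hEpos.le
  have htailE : (2 / E) ^ (8 * m₀) = (8 / lam) ^ (8 * m₀) / (1 + (i : ℝ)) ^ 8 := tail_pow_eight_mul_eq hl m₀ i hm
  obtain ⟨hwin, hs1⟩ := supWindow_of_pow_le hA1 hs hm hi1 hw
  set μ := gibbsWeight ω₂ lam β γ N T with hμ
  set ν : Measure ℝ := gaussianReal 0 (Real.toNNReal T) with hν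
  haveI : IsFiniteMeasure μ := isFiniteMeasure_gibbsWeight hω hl.le hβ γ N hT
  haveI : IsProbabilityMeasure ν := by rw [hν]; infer_instance
  set Z : ℝ := ∫ x, Real.exp (-((pinnedChain ω₂ lam β γ).hamiltonian N x) / T) ∂volume with hZ
  have hZ0 : 0 ≤ Z := integral_nonneg fun x => (Real.exp_pos _).le
  have hZreal : μ.real univ = Z := by
    have h1 : ∫ _x : PhaseSpace N, (1 : ℝ) ∂μ = Z := by
      rw [hμ, integral_gibbsWeight γ N T (fun _ => (1 : ℝ))]
      simp only [mul_one, hZ]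
    rw [← h1, integral_const, smul_eq_mul, mul_one]
  have hZprod : (μ.prod ν).real univ = Z := by
    rw [← univ_prod_univ, measureReal_prod_prod, hZreal, probReal_univ, mul_one]
  have hN0 : 0 < N := by omega
  set b0 : Fin N := ⟨0, hN0⟩ with hb0
  set ib : Fin N := ⟨i, by omega⟩ with hib
  set X : Fin N → PhaseSpace N → ℝ := fun m x =>
    (∑ k : Fin N, (if k = m then (1 : ℝ) else 0) * (x.2 k ^ 2 / 2 + (pinnedChain ω₂ lam β 0).U (x.1 k))) +
      ∑ k : Fin N, ∑ l : Fin N, if l.val = k.val + 1 then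
        ((if k = m then (1 : ℝ) else 0) + (if l = m then (1 : ℝ) else 0)) / 2 *
          (pinnedChain ω₂ lam β 0).V (x.1 l - x.1 k) else 0 with hXdef
  set jL : Fin N → PhaseSpace N → ℝ := fun m z =>
    ∑ k : Fin N, if k.val + 1 = m.val then (pinnedChain ω₂ lam β 0).bondCurrent N k z else 0 with hjL
  set jR : Fin N → PhaseSpace N → ℝ := fun m z => (pinnedChain ω₂ lam β 0).bondCurrent N m z with hjR
  set S : Fin N → Set (PhaseSpace N) := fun m => {x | ∀ τ ∈ Icc (0 : ℝ) s, X m (detFlow ω₂ lam β N τ x) ≤ E} with hS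
  set B : Fin N → PhaseSpace N → ℝ := fun m => (S m)ᶜ.indicator (fun _ => E + 1) with hB
  set I : Finset (Fin N) := Finset.univ.filter (fun m : Fin N => m.val ≤ 2 * i + 2) with hI
  set Gs : Set (PhaseSpace N × ℝ) := {z | ∀ m ∈ I, B m z.1 ≤ E ∧
      B m ((z.1.1, Function.update z.1.2 b0 z.2) : PhaseSpace N) ≤ E} with hGs
  set g : PhaseSpace N → ℝ := fun y =>
    (pinnedChain ω₂ lam β γ).bondCurrent N ib (detFlow ω₂ lam β N s y) with hg
  set F : PhaseSpace N × ℝ → ℝ := fun z =>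
    (g ((z.1.1, Function.update z.1.2 b0 z.2) : PhaseSpace N) - g z.1) ^ 2 with hF
  have hU0 : ∀ q, 0 ≤ (pinnedChain ω₂ lam β 0).U q := fun q => by
    show 0 ≤ ω₂ * q ^ 2 / 2 + lam * q ^ 4 / 4; positivity
  have hV0 : ∀ r, 0 ≤ (pinnedChain ω₂ lam β 0).V r := fun r => by
    show 0 ≤ r ^ 2 / 2 + β * r ^ 4 / 4; positivity
  have hX0 : ∀ m x, 0 ≤ X m x := fun m x => siteEnergy_nonneg (pinnedChain ω₂ lam β 0) m (X m) rfl hU0 hV0 x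
  have hXc : ∀ m, Continuous (X m) := fun m => (contDiff_siteEnergy m (X m) rfl).continuous
  have hjLc : ∀ m, Continuous (jL m) := fun m => continuous_leftCurrent ω₂ lam β 0 N m
  have hjRc : ∀ m, Continuous (jR m) := fun m => pinnedChain_continuous_bondCurrent ω₂ lam β 0 N m
  have hSc : ∀ m, IsClosed (S m) := fun m => isClosed_supGood hω hl.le hβ m (X m) rfl s E
  have hBm : ∀ m, StronglyMeasurable (B m) := fun m =>
    stronglyMeasurable_const.indicator (hSc m).measurableSet.compl
  have hGm : MeasurableSet Gs := measurableSet_goodSet b0 I B hBm E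
  have hGS : ∀ z : PhaseSpace N × ℝ, z ∈ Gs ↔
      ((((z.1.1, Function.update z.1.2 b0 z.2) : PhaseSpace N), z.1.2 b0) : PhaseSpace N × ℝ) ∈ Gs :=
    goodSet_resample_iff b0 I B E
  have hgc : Continuous g :=
    (pinnedChain_continuous_bondCurrent ω₂ lam β γ N ib).comp (continuous_detFlow hω hl.le hβ N s)
  have hgm : MemLp g 2 μ := by
    refine memLp_two_of_abs_le_pow hω hl.le hβ γ N hT hgc.aestronglyMeasurable (N * ((3 + β) / 2)) 2 fun y => ?_
    have h := abs_bondCurrent_detFlow_le hω hl.le hβ N γ ib s y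
    simpa only [hg, mul_assoc] using h
  have hG1 : MemLp (fun z : PhaseSpace N × ℝ => g z.1) 2 (μ.prod ν) := hgm.comp_fst ν
  have hG2 : MemLp (fun z : PhaseSpace N × ℝ => g ((z.1.1, Function.update z.1.2 b0 z.2) : PhaseSpace N)) 2 (μ.prod ν) :=
    memLp_resample ω₂ lam β γ hT b0 hgm
  have hFint : Integrable F (μ.prod ν) := by
    have h := (hG2.sub hG1).integrable_sq
    refine h.congr (Eventually.of_forall fun z => ?_)
    simp only [hF, Pi.sub_apply]
  have hBle : ∀ m y, B m y ≤ E ↔ y ∈ S m := fun m y => indicator_compl_le_iff (S m) hE0 y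
  have hcap : ∀ z ∈ Gs, ∀ τ ∈ Icc (0 : ℝ) s, ∀ (n' : ℕ) (h : n' < N), n' ≤ 2 * i + 2 →
      X ⟨n', h⟩ (detFlow ω₂ lam β N τ z.1) ≤ lam * R ^ 4 / 4 ∧
        X ⟨n', h⟩ (detFlow ω₂ lam β N τ (z.1.1, Function.update z.1.2 ⟨0, by omega⟩ z.2)) ≤ lam * R ^ 4 / 4 := by
    intro z hz τ hτ n' hn' hn2
    have hmI : (⟨n', hn'⟩ : Fin N) ∈ I := by simp [hI, hn2]
    obtain ⟨h1, h2⟩ := hz ⟨n', hn'⟩ hmI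
    rw [hBle] at h1 h2
    exact ⟨h1 τ hτ, h2 τ hτ⟩
  set bnd : PhaseSpace N × ℝ → ℝ := fun z =>
    2 * (K₀ * (1 + (i : ℝ))) ^ 2 * ((z.1.2 b0 - z.2) ^ 2 + (2 * A ^ 2 * (1 + (i : ℝ)) * (1 + (i : ℝ))) ^ 2) *
      ((4 / 9 : ℝ) ^ i) with hbnd
  have hbnd0 : ∀ z, 0 ≤ bnd z := fun z => by positivity
  have hgood : ∀ z ∈ Gs, F z ≤ bnd z := by
    intro z hz
    have hk := stub_floorGoodKick ω₂ lam β hω hl hβ N X (fun _ => rfl) i hiN z.1 z.2 R s hR1 hs hwin (hcap z hz)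
    have hk' : |g ((z.1.1, Function.update z.1.2 b0 z.2) : PhaseSpace N) - g z.1| ≤
        (3 / 2 * (1 + 4 * β + (1 + lam) * A) * R ^ 3) * (|z.1.2 b0 - z.2| + 2 * A ^ 2 * R ^ 3 * s) * (2 / 3) ^ i := by
      rw [abs_sub_comm]
      have e : (3 / 2 * (1 + 4 * β + (1 + lam) * A) * R ^ 3) * (|z.1.2 b0 - z.2| + 2 * A ^ 2 * R ^ 3 * s) * (2 / 3) ^ i =
          3 / 2 * (1 + 4 * β + (1 + lam) * Real.sqrt (1 + ω₂ + 3 * lam + 12 * β)) * R ^ 3 *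
            (|z.1.2 ⟨0, by omega⟩ - z.2| + 2 * (1 + ω₂ + 3 * lam + 12 * β) * R ^ 3 * s) * (2 / 3) ^ i := by
        rw [hA2]
      rw [e]
      exact hk
    have hsq := sq_le_of_abs_le_mul hk'
    have hK : 3 / 2 * (1 + 4 * β + (1 + lam) * A) * R ^ 3 ≤ K₀ * (1 + (i : ℝ)) := by
      rw [hK₀]; exact mul_le_mul_of_nonneg_left hR3 (by positivity)
    have hc : 2 * A ^ 2 * R ^ 3 * s ≤ 2 * A ^ 2 * (1 + (i : ℝ)) * (1 + (i : ℝ)) :=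
      mul_le_mul (mul_le_mul_of_nonneg_left hR3 (by positivity)) hs1 hs (by positivity)
    have hK0' : 0 ≤ 3 / 2 * (1 + 4 * β + (1 + lam) * A) * R ^ 3 := by positivity
    have hc0 : 0 ≤ 2 * A ^ 2 * R ^ 3 * s := by positivity
    calc F z = (g ((z.1.1, Function.update z.1.2 b0 z.2) : PhaseSpace N) - g z.1) ^ 2 := rfl
      _ ≤ 2 * (3 / 2 * (1 + 4 * β + (1 + lam) * A) * R ^ 3) ^ 2 *
            (|z.1.2 b0 - z.2| ^ 2 + (2 * A ^ 2 * R ^ 3 * s) ^ 2) * ((2 / 3 : ℝ) ^ i) ^ 2 := hsq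
      _ ≤ 2 * (K₀ * (1 + (i : ℝ))) ^ 2 *
            ((z.1.2 b0 - z.2) ^ 2 + (2 * A ^ 2 * (1 + (i : ℝ)) * (1 + (i : ℝ))) ^ 2) * ((2 / 3 : ℝ) ^ i) ^ 2 := by
          rw [sq_abs]
          gcongr
      _ = bnd z := by
          have e49 : ((2 / 3 : ℝ) ^ i) ^ 2 = (4 / 9 : ℝ) ^ i := by
            rw [← pow_mul, mul_comm, pow_mul]; norm_num
          simp only [hbnd, e49]
  obtain ⟨hkick_int, hkick_eq⟩ := integral_prod_sq_sub hω hβ γ hT hl.le b0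
  have hbnd_int : Integrable bnd (μ.prod ν) :=
    ((hkick_int.add (integrable_const _)).const_mul _).mul_const _
  have hp2 : ∫ x, (x.2 b0) ^ 2 ∂μ ≤ max C1 0 * Z := by
    have h := (hC1 N b0).2
    norm_num at h
    exact h.trans (mul_le_mul_of_nonneg_right (le_max_left _ _) hZ0)
  have hgood_int : ∫ z in Gs, F z ∂(μ.prod ν) ≤ Cg * Z / (1 + (i : ℝ)) ^ 3 := by
    have h1 : ∫ z in Gs, F z ∂(μ.prod ν) ≤ ∫ z in Gs, bnd z ∂(μ.prod ν) :=
      setIntegral_mono_on hFint.integrableOn hbnd_int.integrableOn hGm hgood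
    have h2 : ∫ z in Gs, bnd z ∂(μ.prod ν) ≤ ∫ z, bnd z ∂(μ.prod ν) :=
      setIntegral_le_integral hbnd_int (Eventually.of_forall hbnd0)
    have h3 : ∫ z, bnd z ∂(μ.prod ν) = 2 * (K₀ * (1 + (i : ℝ))) ^ 2 *
        ((∫ x, (x.2 b0) ^ 2 ∂μ) + T * Z + (2 * A ^ 2 * (1 + (i : ℝ)) * (1 + (i : ℝ))) ^ 2 * Z) * (4 / 9 : ℝ) ^ i := by
      simp only [hbnd]
      rw [integral_mul_const, integral_const_mul, integral_add hkick_int (integrable_const _), integral_const,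
        smul_eq_mul, hkick_eq, hZreal, hZprod]
      ring
    have h4 : (∫ x, (x.2 b0) ^ 2 ∂μ) + T * Z + (2 * A ^ 2 * (1 + (i : ℝ)) * (1 + (i : ℝ))) ^ 2 * Z ≤
        (max C1 0 + T + 4 * A ^ 4) * (1 + (i : ℝ)) ^ 4 * Z := by
      have h14 : (1 : ℝ) ≤ (1 + (i : ℝ)) ^ 4 := one_le_pow₀ (by linarith)
      have hm0 : 0 ≤ max C1 0 := le_max_right _ _
      have e1 : (2 * A ^ 2 * (1 + (i : ℝ)) * (1 + (i : ℝ))) ^ 2 * Z = 4 * A ^ 4 * (1 + (i : ℝ)) ^ 4 * Z := by ring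
      have ha' : ∫ x, (x.2 b0) ^ 2 ∂μ ≤ max C1 0 * (1 + (i : ℝ)) ^ 4 * Z :=
        calc ∫ x, (x.2 b0) ^ 2 ∂μ ≤ max C1 0 * Z := hp2
          _ = max C1 0 * 1 * Z := by ring
          _ ≤ max C1 0 * (1 + (i : ℝ)) ^ 4 * Z := by gcongr
      have hb' : T * Z ≤ T * (1 + (i : ℝ)) ^ 4 * Z :=
        calc T * Z = T * 1 * Z := by ring
          _ ≤ T * (1 + (i : ℝ)) ^ 4 * Z := by gcongr
      rw [e1]
      have e2 : (max C1 0 + T + 4 * A ^ 4) * (1 + (i : ℝ)) ^ 4 * Z =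
          max C1 0 * (1 + (i : ℝ)) ^ 4 * Z + T * (1 + (i : ℝ)) ^ 4 * Z + 4 * A ^ 4 * (1 + (i : ℝ)) ^ 4 * Z := by ring
      rw [e2]
      linarith only [ha', hb']
    have h5 : (4 / 9 : ℝ) ^ i * (1 + (i : ℝ)) ^ 6 ≤ G9 / (1 + (i : ℝ)) ^ 3 := by
      rw [le_div_iff₀ (by positivity)]
      calc (4 / 9 : ℝ) ^ i * (1 + (i : ℝ)) ^ 6 * (1 + (i : ℝ)) ^ 3 = (4 / 9 : ℝ) ^ i * (1 + (i : ℝ)) ^ 9 := by ring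
        _ ≤ G9 := geom_mul_pow_le i 9
    calc ∫ z in Gs, F z ∂(μ.prod ν) ≤ ∫ z, bnd z ∂(μ.prod ν) := h1.trans h2
      _ = _ := h3
      _ ≤ 2 * (K₀ * (1 + (i : ℝ))) ^ 2 * ((max C1 0 + T + 4 * A ^ 4) * (1 + (i : ℝ)) ^ 4 * Z) * (4 / 9 : ℝ) ^ i := by
          gcongr
      _ = 2 * K₀ ^ 2 * (max C1 0 + T + 4 * A ^ 4) * Z * ((4 / 9 : ℝ) ^ i * (1 + (i : ℝ)) ^ 6) := by ring
      _ ≤ 2 * K₀ ^ 2 * (max C1 0 + T + 4 * A ^ 4) * Z * (G9 / (1 + (i : ℝ)) ^ 3) :=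
          mul_le_mul_of_nonneg_left h5 (by positivity)
      _ = Cg * Z / (1 + (i : ℝ)) ^ 3 := by simp only [hCg]; ring
  have htail : ∀ m : Fin N, μ.real {x | E < B m x} ≤ Kt * Z / (1 + (i : ℝ)) ^ 7 := by
    intro m
    have hbad : {x | E < B m x} = {x | ∃ τ ∈ Icc (0 : ℝ) s, E < X m (detFlow ω₂ lam β N τ x)} := by
      rw [show (fun x => E < B m x) = fun x => E < (S m)ᶜ.indicator (fun _ => E + 1) x from rfl]
      rw [setOf_lt_indicator_compl (S m) hE0, hS]
      exact compl_setOf_forall_le_eq (fun τ x => X m (detFlow ω₂ lam β N τ x)) s E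
    obtain ⟨hXk_i, hXk⟩ := (hCk N m).1 (X m) rfl
    obtain ⟨hX2n_i, hX2n⟩ := (hC2n N m).1 (X m) rfl
    have hjR2 : Integrable (fun x => |jR m x| ^ 2) μ ∧ ∫ x, |jR m x| ^ 2 ∂μ ≤ C2 * Z := (hC2 N m).2
    have hjL2 : Integrable (fun x => |jL m x| ^ 2) μ ∧ ∫ x, |jL m x| ^ 2 ∂μ ≤ C2 * Z := by
      by_cases hm0 : m.val = 0
      · have e : jL m = fun _ => 0 := funext fun z => leftCurrent_eq_zero (pinnedChain ω₂ lam β 0) hm0 z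
        rw [e]
        simp only [abs_zero, ne_eq, OfNat.ofNat_ne_zero, not_false_eq_true, zero_pow, integral_zero]
        exact ⟨integrable_const _, mul_nonneg hC2_0 hZ0⟩
      · set im : Fin N := ⟨m.val - 1, by omega⟩ with him'
        have him : m.val = im.val + 1 := by simp [him']; omega
        have e : jL m = fun z => (pinnedChain ω₂ lam β 0).bondCurrent N im z :=
          funext fun z => leftCurrent_eq_of_succ (pinnedChain ω₂ lam β 0) him z
        rw [e]
        exact (hC2 N im).2
    set W : PhaseSpace N → ℝ := fun x => X m x ^ n * (|jL m x| + |jR m x|) with hW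
    have hWc : Continuous W := ((hXc m).pow n).mul ((hjLc m).abs.add (hjRc m).abs)
    have hWle : ∀ x, W x ≤ X m x ^ (2 * n) / 2 + (|jL m x| ^ 2 + |jR m x| ^ 2) := fun x =>
      pow_mul_add_le_sq (X m x) |jL m x| |jR m x| n
    have hW0 : ∀ x, 0 ≤ W x := fun x =>
      mul_nonneg (pow_nonneg (hX0 m x) n) (add_nonneg (abs_nonneg _) (abs_nonneg _))
    have hJ2i : Integrable (fun x => |jL m x| ^ 2 + |jR m x| ^ 2) μ := hjL2.1.add hjR2.1
    have hDom : Integrable (fun x => X m x ^ (2 * n) / 2 + (|jL m x| ^ 2 + |jR m x| ^ 2)) μ :=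
      (hX2n_i.div_const 2).add hJ2i
    have hWi : Integrable W μ := by
      refine hDom.mono' hWc.aestronglyMeasurable (Eventually.of_forall fun x => ?_)
      rw [Real.norm_of_nonneg (hW0 x)]
      exact hWle x
    have hWint : ∫ x, W x ∂μ ≤ (C2n / 2 + 2 * C2) * Z := by
      calc ∫ x, W x ∂μ ≤ ∫ x, (X m x ^ (2 * n) / 2 + (|jL m x| ^ 2 + |jR m x| ^ 2)) ∂μ :=
            integral_mono hWi hDom hWle
        _ = (∫ x, X m x ^ (2 * n) ∂μ) / 2 + ((∫ x, |jL m x| ^ 2 ∂μ) + ∫ x, |jR m x| ^ 2 ∂μ) := by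
            rw [integral_add (hX2n_i.div_const 2) hJ2i, integral_add hjL2.1 hjR2.1, integral_div]
        _ ≤ C2n * Z / 2 + (C2 * Z + C2 * Z) := by gcongr <;> first | exact hX2n | exact hjL2.2 | exact hjR2.2
        _ = (C2n / 2 + 2 * C2) * Z := by ring
    have hmax := measureReal_sup_gt_le_pow hω hl.le hβ γ hT m (X m) rfl (k := 8 * m₀) (n := n) hXk_i hWi hs hEpos
    rw [hbad]
    refine hmax.trans ?_
    rw [hn1, htailE]
    have hI2 : ∫ x, X m x ^ n * (|jL m x| + |jR m x|) ∂μ ≤ (C2n / 2 + 2 * C2) * Z := hWint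
    have hcoef0 : 0 ≤ (8 / lam) ^ (8 * m₀) / (1 + (i : ℝ)) ^ 8 := by positivity
    have hRZ0 : 0 ≤ (C2n / 2 + 2 * C2) * Z := by positivity
    have hCkZ0 : 0 ≤ Ck * Z := by positivity
    have h1i0 : (1 : ℝ) + i ≠ 0 := h1i.ne'
    calc (8 / lam) ^ (8 * m₀) / (1 + (i : ℝ)) ^ 8 * ∫ x, X m x ^ (8 * m₀) ∂μ +
          (8 / lam) ^ (8 * m₀) / (1 + (i : ℝ)) ^ 8 * s * ∫ x, X m x ^ n * (|jL m x| + |jR m x|) ∂μ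
        ≤ (8 / lam) ^ (8 * m₀) / (1 + (i : ℝ)) ^ 8 * (Ck * Z) +
          (8 / lam) ^ (8 * m₀) / (1 + (i : ℝ)) ^ 8 * (1 + (i : ℝ)) * ((C2n / 2 + 2 * C2) * Z) := by
          apply add_le_add
          · exact mul_le_mul_of_nonneg_left hXk hcoef0
          · calc (8 / lam) ^ (8 * m₀) / (1 + (i : ℝ)) ^ 8 * s * ∫ x, X m x ^ n * (|jL m x| + |jR m x|) ∂μ
                ≤ (8 / lam) ^ (8 * m₀) / (1 + (i : ℝ)) ^ 8 * s * ((C2n / 2 + 2 * C2) * Z) :=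
                  mul_le_mul_of_nonneg_left hI2 (by positivity)
              _ ≤ (8 / lam) ^ (8 * m₀) / (1 + (i : ℝ)) ^ 8 * (1 + (i : ℝ)) * ((C2n / 2 + 2 * C2) * Z) :=
                  mul_le_mul_of_nonneg_right (mul_le_mul_of_nonneg_left hs1 hcoef0) hRZ0
      _ ≤ (8 / lam) ^ (8 * m₀) / (1 + (i : ℝ)) ^ 8 * (1 + (i : ℝ)) * (Ck * Z) +
          (8 / lam) ^ (8 * m₀) / (1 + (i : ℝ)) ^ 8 * (1 + (i : ℝ)) * ((C2n / 2 + 2 * C2) * Z) := by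
          refine add_le_add ?_ le_rfl
          calc (8 / lam) ^ (8 * m₀) / (1 + (i : ℝ)) ^ 8 * (Ck * Z)
              = (8 / lam) ^ (8 * m₀) / (1 + (i : ℝ)) ^ 8 * 1 * (Ck * Z) := by ring
            _ ≤ (8 / lam) ^ (8 * m₀) / (1 + (i : ℝ)) ^ 8 * (1 + (i : ℝ)) * (Ck * Z) :=
                mul_le_mul_of_nonneg_right (mul_le_mul_of_nonneg_left h1i1 hcoef0) hCkZ0
      _ = Kt * Z / (1 + (i : ℝ)) ^ 7 := by
          have e7 : (8 / lam) ^ (8 * m₀) / (1 + (i : ℝ)) ^ 8 * (1 + (i : ℝ)) = (8 / lam) ^ (8 * m₀) / (1 + (i : ℝ)) ^ 7 := by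
            rw [div_mul_eq_mul_div, div_eq_div_iff (pow_ne_zero 8 h1i0) (pow_ne_zero 7 h1i0)]; ring
          rw [e7, hKt]
          ring
  set δ : ℝ := 2 * ∑ m ∈ I, μ.real {x | E < B m x} with hδ
  have hδ0 : 0 ≤ δ := by positivity
  have hGc : (μ.prod ν) Gsᶜ ≤ ENNReal.ofReal δ := prod_compl_goodSet_le hω hl.le hβ γ hT b0 I B hBm E
  have hδle : δ ≤ Kb * Z / (1 + (i : ℝ)) ^ 6 := by
    have h1 : ∑ m ∈ I, μ.real {x | E < B m x} ≤ ∑ _m ∈ I, Kt * Z / (1 + (i : ℝ)) ^ 7 :=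
      Finset.sum_le_sum fun m _ => htail m
    rw [Finset.sum_const, nsmul_eq_mul] at h1
    have hcard := card_block_le N i
    have hper0 : 0 ≤ Kt * Z / (1 + (i : ℝ)) ^ 7 := by positivity
    calc δ = 2 * ∑ m ∈ I, μ.real {x | E < B m x} := rfl
      _ ≤ 2 * ((I.card : ℝ) * (Kt * Z / (1 + (i : ℝ)) ^ 7)) := by gcongr
      _ ≤ 2 * ((3 * (1 + (i : ℝ))) * (Kt * Z / (1 + (i : ℝ)) ^ 7)) := by gcongr
      _ = Kb * Z / (1 + (i : ℝ)) ^ 6 := by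
          simp only [hKb]
          field_simp
          ring
  have hj4 : Integrable (fun x => ((pinnedChain ω₂ lam β γ).bondCurrent N ib x) ^ 4) μ ∧
      ∫ x, ((pinnedChain ω₂ lam β γ).bondCurrent N ib x) ^ 4 ∂μ ≤ C4 * Z := by
    obtain ⟨h1, h2⟩ := (hC4 N ib).2
    have e : (fun x => |(pinnedChain ω₂ lam β γ).bondCurrent N ib x| ^ 4) =
        fun x => ((pinnedChain ω₂ lam β γ).bondCurrent N ib x) ^ 4 :=
      funext fun x => Even.pow_abs (by norm_num) _
    rw [e] at h1 h2
    exact ⟨h1, h2⟩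
  have hg4 : Integrable (fun x => g x ^ 4) μ ∧ ∫ x, g x ^ 4 ∂μ ≤ C4 * Z := by
    have hmeas : AEStronglyMeasurable (fun x => ((pinnedChain ω₂ lam β γ).bondCurrent N ib x) ^ 4) μ :=
      ((pinnedChain_continuous_bondCurrent ω₂ lam β γ N ib).pow 4).aestronglyMeasurable
    refine ⟨SubBallisticWindow.CoboundaryCeiling.integrable_comp_detFlow_gibbsWeight hω hl.le hβ γ N T hs hj4.1, ?_⟩
    rw [show (fun x => g x ^ 4) = fun x => (fun y => ((pinnedChain ω₂ lam β γ).bondCurrent N ib y) ^ 4)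
      (detFlow ω₂ lam β N s x) from rfl,
      SubBallisticWindow.CoboundaryCeiling.integral_comp_detFlow_gibbsWeight hω hl.le hβ γ N T hs hmeas]
    exact hj4.2
  obtain ⟨_, hbad⟩ := stub_floorBadSplit ω₂ lam β γ hω hl.le hβ N T hT b0 Gs hGm hGS g hgc hg4.1 δ (C4 * Z) hδ0 hGc hg4.2
  have hbad' : ∫ z in Gsᶜ, F z ∂(μ.prod ν) ≤ 4 * Real.sqrt (Kb * C4) * Z / (1 + (i : ℝ)) ^ 3 := by
    have h1 : δ * (C4 * Z) ≤ (Kb * C4) * (Z / (1 + (i : ℝ)) ^ 3) ^ 2 := by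
      have := mul_le_mul_of_nonneg_right hδle (by positivity : 0 ≤ C4 * Z)
      calc δ * (C4 * Z) ≤ Kb * Z / (1 + (i : ℝ)) ^ 6 * (C4 * Z) := this
        _ = (Kb * C4) * (Z / (1 + (i : ℝ)) ^ 3) ^ 2 := by field_simp
    have h2 : Real.sqrt (δ * (C4 * Z)) ≤ Real.sqrt (Kb * C4) * (Z / (1 + (i : ℝ)) ^ 3) := by
      calc Real.sqrt (δ * (C4 * Z)) ≤ Real.sqrt ((Kb * C4) * (Z / (1 + (i : ℝ)) ^ 3) ^ 2) := Real.sqrt_le_sqrt h1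
        _ = Real.sqrt (Kb * C4) * (Z / (1 + (i : ℝ)) ^ 3) := by
            rw [Real.sqrt_mul (by positivity), Real.sqrt_sq (by positivity)]
    calc ∫ z in Gsᶜ, F z ∂(μ.prod ν) ≤ 4 * Real.sqrt (δ * (C4 * Z)) := hbad
      _ ≤ 4 * (Real.sqrt (Kb * C4) * (Z / (1 + (i : ℝ)) ^ 3)) := by gcongr
      _ = _ := by ring
  calc ∫ x, (∫ p', ((pinnedChain ω₂ lam β γ).bondCurrent N ⟨i, by omega⟩
            (detFlow ω₂ lam β N s (x.1, Function.update x.2 ⟨0, by omega⟩ p')) -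
          (pinnedChain ω₂ lam β γ).bondCurrent N ⟨i, by omega⟩ (detFlow ω₂ lam β N s x)) ^ 2 ∂ν) ∂μ
      = ∫ z, F z ∂(μ.prod ν) := (integral_prod F hFint).symm
    _ = (∫ z in Gs, F z ∂(μ.prod ν)) + ∫ z in Gsᶜ, F z ∂(μ.prod ν) := (integral_add_compl hGm hFint).symm
    _ ≤ Cg * Z / (1 + (i : ℝ)) ^ 3 + 4 * Real.sqrt (Kb * C4) * Z / (1 + (i : ℝ)) ^ 3 := add_le_add hgood_int hbad'
    _ = (Cg + 4 * Real.sqrt (Kb * C4)) * Z / (1 + (i : ℝ)) ^ 3 := by ring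

end Core

/-! ### Registered sub-goal of the line (closed form of `kickCone_supFloor_core`) -/

/-- **Sub-goal `stub_floorSupCore`** (registered on the crux item for this helper file; closed `∀`-form of
`kickCone_supFloor_core`): the `N`-uniform resampled-kick cone of the closed pinned FPU-β chain in every power window,
contact `b = 0`. [folklore] -/
theorem stub_floorSupCore : ∀ (ω₂ lam β γ : ℝ), 0 < ω₂ → 0 < lam → 0 ≤ β → ∀ (T : ℝ), 0 < T → ∀ (m₀ : ℕ), 1 ≤ m₀ → ∃ a C : ℝ, 0 < a ∧ 0 ≤ C ∧ ∀ (N i : ℕ) (hi1 : 1 ≤ i) (hiN : i + 1 < N) (s : ℝ), 0 ≤ s → s ^ (4 * m₀) ≤ a * (1 + (i : ℝ)) ^ (4 * m₀ - 1) → ∫ x, (∫ p', ((pinnedChain ω₂ lam β γ).bondCurrent N ⟨i, by omega⟩ (Summit.AtomisticToContinuum.FouriersLaw.Theorems.ClosedConeSensitivity.Negative.ZeroFrictionDictionary.detFlow ω₂ lam β N s (x.1, Function.update x.2 ⟨0, by omega⟩ p')) - (pinnedChain ω₂ lam β γ).bondCurrent N ⟨i, by omega⟩ (Summit.AtomisticToContinuum.FouriersLaw.Theorems.ClosedConeSensitivity.Negative.ZeroFrictionDictionary.detFlow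 ω₂ lam β N s x)) ^ 2 ∂(ProbabilityTheory.gaussianReal 0 (Real.toNNReal T))) ∂(gibbsWeight ω₂ lam β γ N T) ≤ C * (∫ x, Real.exp (-((pinnedChain ω₂ lam β γ).hamiltonian N x) / T) ∂MeasureTheory.volume) / (1 + (i : ℝ)) ^ 3 :=
  fun _ _ _ γ hω hl hβ _ hT m₀ hm => kickCone_supFloor_core hω hl hβ γ hT m₀ hm

end Summit.AtomisticToContinuum.FouriersLaw.Theorems.OddSectorIrreversibility.TapLeak

end
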